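import Summits.MatrixMultiplication.MatrixMultiplication.Theorems.OutsiderSandwichNoTightBorder
import Summits.MatrixMultiplication.MatrixMultiplication.Theorems.OutsiderSandwichSliceRank
import HarnessLib

/-!
# The slice-rank floor is BORDER-CLOSED: `m·4^N + B·2^{N-1} ≤ B·4^N` for degenerations

Route `OutsiderSandwich` (decomposition cell `decomp-mm`, lens 4 «minimal counterexample /
extremal reduction», gen 29), support for the aside leaf `BlockOneIsMM`
(stmt-MatrixMultiplication-27147).

`OutsiderSandwichSliceRank.amortised_floor` bounds the amortised RESTRICTION table from below by
counting the kernel of the input-leg slices of `⟨B⟩ ⊠ P^{⊠N}` (`P ≅ C₁` the pair tensor):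
`rank S_ω ≤ B·4^N − B·2^{N-1}` for EVERY weight `ω`, while the identity-pattern slice of
`⟨m⟩ ⊠ ⟨2,2,2⟩^{⊠N}` is the identity of rank `m·4^N`.  A rank bound valid for ALL slices is a closed
condition (vanishing of all minors of a fixed size of the slice pencil), so it survives
degeneration.  This file proves the transfer in coordinates over `ℂ[ε]` (BCS (15.19)):

**Theorem** (`border_floor`). `⟨B⟩ ⊠ C₁^{⊠(n+1)} ⊵_deg ⟨m⟩ ⊠ ⟨2,2,2⟩^{⊠(n+1)}` (a degeneration of
some order `h`) implies `m·4^{n+1} + B·2^n ≤ B·4^{n+1}`.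

Proof.  Transport the identity-pattern slice over `ℂ[ε]` (`slice_restrict`):
`A(ε)·S(ε)·D(ε)ᵀ = P(ε)` with `S(ε)` an input slice of `⟨B⟩ ⊠ P^{⊠(n+1)}` with polynomial weights and
`P(ε) = ε^h·(1 + ε E(ε))`, so `det P(ε) ≠ 0` in `ℂ[ε]` (`det_ne_zero_of_coeff`).  Evaluate at a
complex number `c` with `det P(c) ≠ 0` (a non-zero polynomial over the infinite field `ℂ` has a
non-root): `A(c)·S(c)·D(c)ᵀ = P(c)` is invertible of size `m·4^{n+1}`, and `S(c)` is an HONEST input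
slice of `⟨B⟩ ⊠ P^{⊠(n+1)}` over `ℂ` (at the weight `ω(c)`), whose rank is at most
`B·4^{n+1} − B·2^n` by `OutsiderSandwichSliceRank.rank_slice_add_le`.

Consequences: the level-one border floor `4m ≤ 3B` (`border_level_one_floor`), hence
`⟨3⟩ ⊠ C₁ ⋭_deg ⟨3⟩ ⊠ ⟨2,2,2⟩` is sharpened to «`⟨B⟩ ⊠ C₁ ⊵_deg ⟨3⟩ ⊠ ⟨2,2,2⟩` needs `B ≥ 4`»
(`four_le_of_deg_three`), «`… ⊵_deg ⟨2⟩ ⊠ ⟨2,2,2⟩` needs `B ≥ 3`», and in general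
`B ≥ ⌈4m/3⌉` at level one and `B/m ≥ 1/(1 − 2^{−(N+1)})` at level `N` — the same floor as for
restriction, now for the whole orbit closure.  (`OutsiderSandwichBorderTable` shows the level-one
border floor is ATTAINED: `⟨4⟩ ⊠ C₁ ⊵_deg ⟨3⟩ ⊠ ⟨2,2,2⟩`, whereas restriction needs `5` copies.)

## References
* P. Bürgisser, M. Clausen, M. A. Shokrollahi, *Algebraic Complexity Theory*, Springer 1997,
  §14.4 (substitution / flattening), (15.19)–(15.25) (degeneration of order `h`).
  [BurgisserClausenShokrollahi1997]
* D. Coppersmith, S. Winograd, *Matrix multiplication via arithmetic progressions*,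
  J. Symbolic Comput. 9 (1990) 251–280, §7. [CoppersmithWinograd1990]
* M. Bläser, *Fast Matrix Multiplication*, Theory of Computing Library, Graduate Surveys 5 (2013),
  §6 (border rank, semicontinuity of rank). [Blaser2013]
-/

noncomputable section

open scoped BigOperators Matrix Polynomial

set_option linter.dupNamespace false
set_option autoImplicit false

namespace Summit.MatrixMultiplication.MatrixMultiplication.Theorems.OutsiderSandwichBorderFloor

open Polynomial (C X)
open Literature.Computability.AlgebraicComplexity
open Summit.MatrixMultiplication.MatrixMultiplication.Theorems.OutsiderSandwichCoupling (coupling₁)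
open Summit.MatrixMultiplication.MatrixMultiplication.Theorems.OutsiderSandwichNoTightExchange
  (slice slice_apply slice_restrict J src tgt idWeight slice_tgt_idWeight src_restrictsTo_coupling
    le_of_amortised)
open Summit.MatrixMultiplication.MatrixMultiplication.Theorems.OutsiderSandwichNoTightBorder
  (srcX srcX_apply)
open Summit.MatrixMultiplication.MatrixMultiplication.Theorems.OutsiderSandwichSliceRank
  (rank_slice_add_le)

/-! ## 1. A polynomial matrix `ε^h (1 + ε E)` is non-singular over `ℂ[ε]` -/

/-- If the coefficients of a square polynomial matrix `P` vanish below degree `h` and form the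
identity matrix in degree `h`, then `det P ≠ 0` in the domain `ℂ[ε]`
(`P = ε^h Q`, `det Q` has constant coefficient `1`). [cite: BurgisserClausenShokrollahi1997, (15.19)] -/
theorem det_ne_zero_of_coeff {ι : Type} [Fintype ι] [DecidableEq ι] (P : Matrix ι ι ℂ[X]) (h : ℕ)
    (hcoeff : ∀ a c, ∀ j ≤ h, (P a c).coeff j = if j = h then (1 : Matrix ι ι ℂ) a c else 0) :
    P.det ≠ 0 := by
  have hdvd : ∀ a c, (X : ℂ[X]) ^ h ∣ P a c := fun a c =>
    Polynomial.X_pow_dvd_iff.mpr fun d hd => by rw [hcoeff a c d hd.le, if_neg hd.ne]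
  set Q : Matrix ι ι ℂ[X] := Matrix.of fun a c => P a c /ₘ ((X : ℂ[X]) ^ h) with hQ
  have hPQ : P = ((X : ℂ[X]) ^ h) • Q := by
    refine Matrix.ext fun a c => ?_
    rw [Matrix.smul_apply, hQ, Matrix.of_apply, smul_eq_mul]
    have h1 := Polynomial.modByMonic_add_div (P a c) ((X : ℂ[X]) ^ h)
    rw [(Polynomial.modByMonic_eq_zero_iff_dvd (Polynomial.monic_X_pow h)).mpr (hdvd a c),
      zero_add] at h1
    exact h1.symm
  have hQ0 : ∀ a c, (Q a c).coeff 0 = (1 : Matrix ι ι ℂ) a c := by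
    intro a c
    have h1 : (P a c).coeff (0 + h) = (Q a c).coeff 0 := by
      rw [hPQ, Matrix.smul_apply, smul_eq_mul, Polynomial.coeff_X_pow_mul]
    rw [← h1, zero_add, hcoeff a c h le_rfl, if_pos rfl]
  have hdetQ : Q.det ≠ 0 := by
    intro h0
    have hmap : (Polynomial.constantCoeff : ℂ[X] →+* ℂ).mapMatrix Q = 1 := by
      refine Matrix.ext fun a c => ?_
      rw [RingHom.mapMatrix_apply, Matrix.map_apply, Polynomial.constantCoeff_apply, hQ0]
    have h1 := RingHom.map_det (Polynomial.constantCoeff : ℂ[X] →+* ℂ) Q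
    rw [h0, map_zero, hmap, Matrix.det_one] at h1
    exact zero_ne_one h1
  rw [hPQ, Matrix.det_smul]
  exact mul_ne_zero (pow_ne_zero _ (pow_ne_zero _ Polynomial.X_ne_zero)) hdetQ

/-- A non-zero polynomial over `ℂ` has a non-root. [folklore] -/
theorem exists_eval_ne_zero {p : ℂ[X]} (hp : p ≠ 0) : ∃ c : ℂ, p.eval c ≠ 0 := by
  by_contra hall
  push Not at hall
  exact hp (Polynomial.zero_of_eval_zero _ hall)

/-! ## 2. Evaluating polynomial slices -/

/-- Evaluating the input slice of `⟨B⟩ ⊠ P^{⊠N}` with polynomial weights at `ε = c` gives the honest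
input slice at the evaluated weight. [cite: BurgisserClausenShokrollahi1997, §14.4] -/
theorem map_slice_srcX_eval (N B : ℕ) (ω : J N B → ℂ[X]) (c : ℂ) :
    (slice (srcX N B) ω).map (Polynomial.evalRingHom c) =
      slice (src N B) (fun b => (ω b).eval c) := by
  ext a z
  simp only [Matrix.map_apply, slice_apply, srcX_apply, Polynomial.coe_evalRingHom,
    Polynomial.eval_finsetSum, Polynomial.eval_mul, Polynomial.eval_C]

/-- Evaluation commutes with the determinant. [folklore] -/
theorem det_map_eval {ι : Type} [Fintype ι] [DecidableEq ι] (P : Matrix ι ι ℂ[X]) (c : ℂ) :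
    (P.map (Polynomial.evalRingHom c)).det = P.det.eval c := by
  rw [← RingHom.mapMatrix_apply, ← RingHom.map_det, Polynomial.coe_evalRingHom]

/-! ## 3. The border floor -/

/-- **The slice-rank floor is border-closed**: a degeneration
`⟨B⟩ ⊠ C₁^{⊠(n+1)} ⊵ ⟨m⟩ ⊠ ⟨2,2,2⟩^{⊠(n+1)}` (BCS (15.19), any order) forces
`m·4^{n+1} + B·2^n ≤ B·4^{n+1}`. [cite: BurgisserClausenShokrollahi1997, §14.4] -/
theorem border_floor {n B m : ℕ}
    (h : AlgDegeneratesTo (kroneckerTensor (unitTensor ℂ B) (kroneckerPow coupling₁ (n + 1)))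
      (kroneckerTensor (unitTensor ℂ m) (kroneckerPow (matMulTensor ℂ 2 2 2) (n + 1)))) :
    m * 4 ^ (n + 1) + B * 2 ^ n ≤ B * 4 ^ (n + 1) := by
  obtain ⟨hh, A, B', D, happ⟩ := (src_restrictsTo_coupling (n + 1) B).algDegeneratesTo_trans h
  -- the degenerating family `u = (A, B', D)·srcX` over `ℂ[ε]`
  set u : J (n + 1) m → J (n + 1) m → J (n + 1) m → ℂ[X] :=
    fun a' b' c' => ∑ a, ∑ b, ∑ c, A a' a * B' b' b * D c' c * srcX (n + 1) B a b c with hu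
  have hcoeff_u : ∀ a b c, ∀ j ≤ hh,
      (u a b c).coeff j = if j = hh then tgt (n + 1) m a b c else 0 :=
    fun a b c j hj => happ a b c j hj
  -- slice transport over `ℂ[ε]` at the identity-pattern weight
  set w' : J (n + 1) m → ℂ[X] := fun x => C (idWeight (n + 1) m x) with hw'
  have key := slice_restrict (K := ℂ[X]) (s := srcX (n + 1) B) (t := u) A B' D
    (fun _ _ _ => rfl) w'
  set P : Matrix (J (n + 1) m) (J (n + 1) m) ℂ[X] := slice u w' with hP
  set ωX : J (n + 1) B → ℂ[X] := fun b => ∑ b', w' b' * B' b' b with hωX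
  -- (1) the coefficients of `P` up to order `hh`: `P = ε^hh (1 + ε E)`, so `det P ≠ 0`
  have hcoeff : ∀ a c, ∀ j ≤ hh,
      (P a c).coeff j = if j = hh then (1 : Matrix (J (n + 1) m) (J (n + 1) m) ℂ) a c else 0 := by
    intro a c j hj
    rw [hP, slice_apply, Polynomial.finsetSum_coeff]
    have hterm : ∀ b, (w' b * u a b c).coeff j =
        idWeight (n + 1) m b * (if j = hh then tgt (n + 1) m a b c else 0) := by
      intro b
      rw [hw', Polynomial.coeff_C_mul, hcoeff_u a b c j hj]
    simp only [hterm]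
    split_ifs with hjh
    · have h1 := congrFun (congrFun (slice_tgt_idWeight (n + 1) m) a) c
      rw [slice_apply] at h1
      exact h1
    · simp
  have hdetP : P.det ≠ 0 := det_ne_zero_of_coeff P hh hcoeff
  -- (2) evaluate at a non-root `c` of `det P`
  obtain ⟨c, hc⟩ := exists_eval_ne_zero hdetP
  have hmul : P.map (Polynomial.evalRingHom c) =
      (Matrix.of A).map (Polynomial.evalRingHom c) *
        slice (src (n + 1) B) (fun b => (ωX b).eval c) *
        ((Matrix.of D)ᵀ).map (Polynomial.evalRingHom c) := by
    rw [key, Matrix.map_mul, Matrix.map_mul, map_slice_srcX_eval]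
  have hunit : IsUnit (P.map (Polynomial.evalRingHom c)) := by
    rw [Matrix.isUnit_iff_isUnit_det, det_map_eval, isUnit_iff_ne_zero]
    exact hc
  have hrankP : (P.map (Polynomial.evalRingHom c)).rank = m * 4 ^ (n + 1) := by
    rw [Matrix.rank_of_isUnit _ hunit]
    simp only [Fintype.card_prod, Fintype.card_fin, Fintype.card_pi, Finset.prod_const,
      Finset.card_univ]
  -- (3) rank comparison with an honest slice of the source
  have hle : (P.map (Polynomial.evalRingHom c)).rank ≤
      (slice (src (n + 1) B) (fun b => (ωX b).eval c)).rank := by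
    rw [hmul]
    exact (Matrix.rank_mul_le_left _ _).trans (Matrix.rank_mul_le_right _ _)
  have h2 := rank_slice_add_le (n := n) (B := B) (fun b => (ωX b).eval c)
  omega

/-! ## 4. The first two rows of the border table from below -/

/-- **Level one: `4m ≤ 3B`** for BORDER certificates `⟨B⟩ ⊠ C₁ ⊵_deg ⟨m⟩ ⊠ ⟨2,2,2⟩` — the
level-one border ratio is at least `4/3`. [cite: CoppersmithWinograd1990, §7] -/
theorem border_level_one_floor {B m : ℕ}
    (h : AlgDegeneratesTo (kroneckerTensor (unitTensor ℂ B) (kroneckerPow coupling₁ 1))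
      (kroneckerTensor (unitTensor ℂ m) (kroneckerPow (matMulTensor ℂ 2 2 2) 1))) :
    4 * m ≤ 3 * B := by
  have := border_floor (n := 0) h
  omega

/-- **Level two: `8m ≤ 7B`** for border certificates `⟨B⟩ ⊠ C₁^{⊠2} ⊵_deg ⟨m⟩ ⊠ ⟨2,2,2⟩^{⊠2}`.
[cite: CoppersmithWinograd1990, §7] -/
theorem border_level_two_floor {B m : ℕ}
    (h : AlgDegeneratesTo (kroneckerTensor (unitTensor ℂ B) (kroneckerPow coupling₁ 2))
      (kroneckerTensor (unitTensor ℂ m) (kroneckerPow (matMulTensor ℂ 2 2 2) 2))) :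
    8 * m ≤ 7 * B := by
  have := border_floor (n := 1) h
  omega

/-- `⟨B⟩ ⊠ C₁ ⊵_deg ⟨2⟩ ⊠ ⟨2,2,2⟩` needs `B ≥ 3` (attained by restriction, `OutsiderSandwichYield`).
[cite: CoppersmithWinograd1990, §7] -/
theorem three_le_of_deg_two {B : ℕ}
    (h : AlgDegeneratesTo (kroneckerTensor (unitTensor ℂ B) (kroneckerPow coupling₁ 1))
      (kroneckerTensor (unitTensor ℂ 2) (kroneckerPow (matMulTensor ℂ 2 2 2) 1))) :
    3 ≤ B := by
  have := border_level_one_floor h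
  omega

/-- **`⟨B⟩ ⊠ C₁ ⊵_deg ⟨3⟩ ⊠ ⟨2,2,2⟩` needs `B ≥ 4`** (restriction needs `5`,
`OutsiderSandwichLevelOne.amortisedNumber_one_three_eq`; `4` is attained by a degeneration,
`OutsiderSandwichBorderTable`). [cite: CoppersmithWinograd1990, §7] -/
theorem four_le_of_deg_three {B : ℕ}
    (h : AlgDegeneratesTo (kroneckerTensor (unitTensor ℂ B) (kroneckerPow coupling₁ 1))
      (kroneckerTensor (unitTensor ℂ 3) (kroneckerPow (matMulTensor ℂ 2 2 2) 1))) :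
    4 ≤ B := by
  have := border_level_one_floor h
  omega

/-- `⟨B⟩ ⊠ C₁ ⊵_deg ⟨4⟩ ⊠ ⟨2,2,2⟩` needs `B ≥ 6`: five copies of `C₁` do not even DEGENERATE to four
independent `2 × 2` products. [cite: CoppersmithWinograd1990, §7] -/
theorem six_le_of_deg_four {B : ℕ}
    (h : AlgDegeneratesTo (kroneckerTensor (unitTensor ℂ B) (kroneckerPow coupling₁ 1))
      (kroneckerTensor (unitTensor ℂ 4) (kroneckerPow (matMulTensor ℂ 2 2 2) 1))) :
    6 ≤ B := by
  have := border_level_one_floor h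
  omega

/-- `⟨B⟩ ⊠ C₁^{⊠2} ⊵_deg ⟨7⟩ ⊠ ⟨2,2,2⟩^{⊠2}` needs `B ≥ 8`: the level-two border floor sits at the
format `128 → 112`. [cite: CoppersmithWinograd1990, §7] -/
theorem eight_le_of_deg_two_seven {B : ℕ}
    (h : AlgDegeneratesTo (kroneckerTensor (unitTensor ℂ B) (kroneckerPow coupling₁ 2))
      (kroneckerTensor (unitTensor ℂ 7) (kroneckerPow (matMulTensor ℂ 2 2 2) 2))) :
    8 ≤ B := by
  have := border_level_two_floor h
  omega

/-- The multiplicity-`m` tight case remains excluded at every level (`OutsiderSandwichNoTightBorder`),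
and the floor quantifies the gap: `B − m ≥ B·2^n/4^{n+1}`, i.e. `B ≥ m/(1 − 2^{−(n+2)})`.
[cite: CoppersmithWinograd1990, §7] -/
theorem sub_floor {n B m : ℕ}
    (h : AlgDegeneratesTo (kroneckerTensor (unitTensor ℂ B) (kroneckerPow coupling₁ (n + 1)))
      (kroneckerTensor (unitTensor ℂ m) (kroneckerPow (matMulTensor ℂ 2 2 2) (n + 1)))) :
    B * 2 ^ n ≤ (B - m) * 4 ^ (n + 1) := by
  have h1 := border_floor h
  have hmB : m ≤ B := le_of_amortised h
  have e : (B - m) * 4 ^ (n + 1) = B * 4 ^ (n + 1) - m * 4 ^ (n + 1) := Nat.sub_mul B m _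
  omega

end Summit.MatrixMultiplication.MatrixMultiplication.Theorems.OutsiderSandwichBorderFloor
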